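import Summits.ABC.StewartYu.PadicW80ParE
import HarnessLib

/-!
# The `p`-adic Waldschmidt parameter record — Siegel count (sequel of `PadicW80ParE`)

Support file (theorems only): `padic_siegel_count` — twice the number of Siegel equations at level
`0`, `2·#((range S₀) ×ˢ tauSet d T)`, is at most the number of unknowns `#box₀` for the record
`PadicW80Par` (`c_S = 2¹⁵`: exponent slack `33(d+1) − 31` bits). [cite: Waldschmidt1980, Lemma 3.2 (p. 266)]
-/

noncomputable section

open Finset Real
open Literature.NumberTheory.Transcendental Literature.NumberTheory.Transcendental.Waldschmidt1980

namespace Summit.ABC.StewartYu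

namespace PadicW80Par

open Literature.NumberTheory.Transcendental.CW77 Literature.NumberTheory.Transcendental.CW77.Setup

/-- **The count of Lemma 3.2**: twice the number of equations `(s, τ)`, `s < S₀`, `|τ| < T`, is at
most the number of unknowns `#box₀ = h L_b ∏(Lallᵢ + 1)` — with the factorial of
`#tauSet ≤ (T+d)^{d+1}/(d+1)!` against the `m^{2m+1}/m!` of `U`.
[cite: Waldschmidt1980, Lemma 3.2 and (3.6) (pp. 264–267)] -/
theorem padic_siegel_count (S : CW77.Setup) (P : PadicW80Par S.d) :
    2 * ((range P.S₀p) ×ˢ tauSet S.d P.Tp).card ≤ (S.box (h := P.hparp) (Lb := P.Lbp) P.Lp P.Lθp 0).card := by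
  rw [S.card_box, card_product, card_range]
  simp only [pow_zero, Nat.div_one]
  -- pass to the reals
  have hprodL : (∏ j, (P.Lp j + 1)) * (P.Lθp + 1) = ∏ i, (P.Lallp i + 1) := by
    rw [Fin.prod_univ_castSucc]; simp
  rw [hprodL]
  suffices key : (2 : ℝ) * (P.S₀p * ((tauSet S.d P.Tp).card : ℝ)) ≤ P.hparp * P.Lbp * ∏ i, ((P.Lallp i : ℝ) + 1) by
    exact_mod_cast key
  -- notation and basic facts
  have hm0 := mR_pos P; have hm2 := two_le_mR P
  have hW := P.one_le_Wstar; have hG := P.G_pos; have hU := P.U_pos; have h𝔘 := P.𝔘_pos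
  have hS := P.S₀_pos; have hT := P.T_pos
  have em : ((S.d + 1 : ℕ) : ℝ) = mRp S.d := by unfold mRp; push_cast; ring
  -- (1) the count of `τ`
  have h1 : ((tauSet S.d P.Tp).card : ℝ) ≤ (2 * (P.Tp : ℝ)) ^ (S.d + 1) / (S.d + 1).factorial := by
    have h := Waldschmidt1980.card_tauSet_le_pow_div_factorial S.d P.Tp
    have hTd : (P.Tp : ℝ) + S.d ≤ 2 * P.Tp := by
      -- `d ≤ T` from `T ≥ 2^{11} m² Vθ Lθ ≥ 2^{11} m²`
      have h2 := P.T_ge_Lθ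
      have hL : (1 : ℝ) ≤ P.Lθp := by exact_mod_cast P.one_le_Lθ
      have hV := P.one_le_Vθ
      have hd : (S.d : ℝ) ≤ mRp S.d := by unfold mRp; linarith
      have : (S.d : ℝ) ≤ 2 ^ 11 * mRp S.d ^ 2 * P.Vel * P.Lθp := by
        have h3 : mRp S.d ≤ 2 ^ 11 * mRp S.d ^ 2 * P.Vel * P.Lθp := by
          calc mRp S.d = 1 * (mRp S.d * 1) * 1 * 1 := by ring
            _ ≤ 2 ^ 11 * (mRp S.d * mRp S.d) * P.Vel * P.Lθp := by gcongr <;> linarith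
            _ = 2 ^ 11 * mRp S.d ^ 2 * P.Vel * P.Lθp := by ring
        linarith
      linarith
    calc ((tauSet S.d P.Tp).card : ℝ) ≤ ((P.Tp : ℝ) + S.d) ^ (S.d + 1) / (S.d + 1).factorial := h
      _ ≤ (2 * (P.Tp : ℝ)) ^ (S.d + 1) / (S.d + 1).factorial := by gcongr
  -- (2) `T ≤ 𝔘/(c_T W⋆)`
  have h2 : (P.Tp : ℝ) ≤ P.𝔘p / (cTp * P.Wstarp) := by
    have := P.T_le
    rw [P.U_eq] at this
    have e : 2 ^ (S.d + 1) * P.𝔘p / (cTp * 2 ^ (S.d + 1) * P.Wstarp) = P.𝔘p / (cTp * P.Wstarp) := by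
      unfold cTp; field_simp
    rw [← e]; exact this
  -- (3) the lower bounds for the unknowns
  have h3 : P.𝔘p / (cLp * P.Gp) ≤ (P.hparp : ℝ) * P.Lbp := by
    have hh := P.hpar_pos
    have hLb : P.Up / (cLp * 2 ^ (S.d + 1) * P.Gp * P.hparp) ≤ (P.Lbp : ℝ) := by
      unfold PadicW80Par.Lbp; push_cast; exact (Nat.lt_floor_add_one _).le
    have e : P.Up / (cLp * 2 ^ (S.d + 1) * P.Gp * P.hparp) = P.𝔘p / (cLp * P.Gp) / P.hparp := by
      rw [P.U_eq]; unfold cLp; field_simp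
    rw [e, div_le_iff₀ hh] at hLb
    linarith
  have h4 : ∀ i, P.Up / (cLp' * mRp S.d * 2 ^ (S.d + 2) * P.S₀p * P.Vallp i) ≤ (P.Lallp i : ℝ) + 1 := by
    intro i
    refine Fin.lastCases ?_ (fun j => ?_) i
    · rw [P.Lall_last, P.Vall_last]; unfold PadicW80Par.Lθp; exact (Nat.lt_floor_add_one _).le
    · rw [P.Lall_castSucc, P.Vall_castSucc]; unfold PadicW80Par.Lp; exact (Nat.lt_floor_add_one _).le
  set D : ℝ := cLp' * mRp S.d * 2 ^ (S.d + 2) * P.S₀p with hD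
  have hD0 : 0 < D := by rw [hD]; unfold cLp'; positivity
  have h5 : P.Up ^ (S.d + 1) / (D ^ (S.d + 1) * ∏ i, P.Vallp i) ≤ ∏ i, ((P.Lallp i : ℝ) + 1) := by
    have e : P.Up ^ (S.d + 1) / (D ^ (S.d + 1) * ∏ i, P.Vallp i) = ∏ i, (P.Up / (D * P.Vallp i)) := by
      rw [prod_div_distrib, prod_const, card_univ, Fintype.card_fin, prod_mul_distrib, prod_const, card_univ,
        Fintype.card_fin]
    rw [e]
    refine prod_le_prod (fun i _ => by have := P.Vall_pos i; positivity) fun i _ => ?_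
    have := h4 i
    rwa [show cLp' * mRp S.d * 2 ^ (S.d + 2) * (P.S₀p : ℝ) * P.Vallp i = D * P.Vallp i by rw [hD]] at this
  -- (4) the numerical heart: `2 S₀ (2𝔘/(c_T W⋆))^m/m! ≤ (𝔘/(c_L G)) · U^m/(D^m ∏Vall)`
  have hVall : 0 < ∏ i, P.Vallp i := prod_pos fun i _ => P.Vall_pos i
  have hfac : (0 : ℝ) < (S.d + 1).factorial := by exact_mod_cast Nat.factorial_pos _
  set A₁ : ℝ := 2 * P.S₀p * (2 * P.𝔘p) ^ (S.d + 1) with hA₁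
  set B₁ : ℝ := (cTp * P.Wstarp) ^ (S.d + 1) * (S.d + 1).factorial with hB₁
  set A₂ : ℝ := P.𝔘p * P.Up ^ (S.d + 1) with hA₂
  set B₂ : ℝ := cLp * P.Gp * (D ^ (S.d + 1) * ∏ i, P.Vallp i) with hB₂
  have hB₁0 : 0 < B₁ := by rw [hB₁]; unfold cTp; positivity
  have hB₂0 : 0 < B₂ := by rw [hB₂]; unfold cLp; positivity
  have eL : 2 * ((P.S₀p : ℝ) * ((2 * (P.𝔘p / (cTp * P.Wstarp))) ^ (S.d + 1) / (S.d + 1).factorial)) = A₁ / B₁ := by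
    rw [hA₁, hB₁, show (2 : ℝ) * (P.𝔘p / (cTp * P.Wstarp)) = (2 * P.𝔘p) / (cTp * P.Wstarp) by ring, div_pow,
      div_div, mul_div_assoc, mul_assoc]
  have eR : (P.𝔘p / (cLp * P.Gp)) * (P.Up ^ (S.d + 1) / (D ^ (S.d + 1) * ∏ i, P.Vallp i)) = A₂ / B₂ := by
    rw [hA₂, hB₂, div_mul_div_comm]
  have heart : A₁ / B₁ ≤ A₂ / B₂ := by
    rw [div_le_div_iff₀ hB₁0 hB₂0, hA₁, hB₁, hA₂, hB₂]
    -- `2 S₀ (2𝔘)^m · c_L G D^m ∏Vall ≤ 𝔘 U^m · (c_T W⋆)^m m!`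
    rw [P.U_eq]
    have hprodV : (∏ i, P.Vallp i) = (∏ j, P.Vs j) * P.Vel := by rw [Fin.prod_univ_castSucc]; simp
    have h𝔘eq : P.𝔘p * ((S.d + 1).factorial : ℝ) * 2 ^ (S.d + 1) =
        PadicW80Par.Ap ^ (S.d + 1) * mRp S.d ^ (2 * S.d + 3) * ((∏ j, P.Vs j) * P.Vel) * P.Wstarp * P.Gp := by
      unfold PadicW80Par.𝔘p PadicW80Par.Up; field_simp
    have hS₀ := P.S₀_le
    have hS0' : (0 : ℝ) ≤ P.S₀p := hS.le
    have LHS_le : 2 * (P.S₀p : ℝ) * (2 * P.𝔘p) ^ (S.d + 1) * (cLp * P.Gp * (D ^ (S.d + 1) * ∏ i, P.Vallp i)) ≤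
        2 * (2 * (cSp * mRp S.d * P.Wstarp)) * (2 * P.𝔘p) ^ (S.d + 1) *
          (cLp * P.Gp * ((cLp' * mRp S.d * 2 ^ (S.d + 2) * (2 * (cSp * mRp S.d * P.Wstarp))) ^ (S.d + 1) * ∏ i, P.Vallp i)) := by
      have hDle : D ≤ cLp' * mRp S.d * 2 ^ (S.d + 2) * (2 * (cSp * mRp S.d * P.Wstarp)) := by
        rw [hD]; unfold cLp'; gcongr
      have hcS : (0 : ℝ) < cSp := by unfold cSp; norm_num
      have hcL : (0 : ℝ) < cLp := by unfold cLp; norm_num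
      have h0 : (0 : ℝ) ≤ 2 * (2 * (cSp * mRp S.d * P.Wstarp)) * (2 * P.𝔘p) ^ (S.d + 1) := by positivity
      gcongr
    refine LHS_le.trans ?_
    have e3 : ((2 : ℝ) ^ (S.d + 1)) ^ (S.d + 1) = (2 ^ (S.d + 1)) ^ S.d * 2 ^ (S.d + 1) := pow_succ _ _
    have eRR : P.𝔘p * (2 ^ (S.d + 1) * P.𝔘p) ^ (S.d + 1) * ((cTp * P.Wstarp) ^ (S.d + 1) * (S.d + 1).factorial) =
        (P.𝔘p * ((S.d + 1).factorial : ℝ) * 2 ^ (S.d + 1)) * (2 ^ (S.d + 1)) ^ S.d * P.𝔘p ^ (S.d + 1) * cTp ^ (S.d + 1) *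
          P.Wstarp ^ (S.d + 1) := by
      rw [mul_pow, mul_pow, e3]; ring
    rw [eRR, h𝔘eq, hprodV]
    unfold cSp cLp cLp' cTp
    set M : ℝ := mRp S.d ^ (2 * S.d + 3) * ((∏ j, P.Vs j) * P.Vel) * P.Wstarp * P.Gp * P.𝔘p ^ (S.d + 1) * P.Wstarp ^ (S.d + 1)
      with hM
    have key : (2 : ℝ) * (2 * (2 ^ 15 * mRp S.d * P.Wstarp)) * (2 * P.𝔘p) ^ (S.d + 1) *
        (2 ^ 14 * P.Gp * ((2 ^ 12 * mRp S.d * 2 ^ (S.d + 2) * (2 * (2 ^ 15 * mRp S.d * P.Wstarp))) ^ (S.d + 1) * ((∏ j, P.Vs j) * P.Vel)))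
        = ((2 : ℝ) ^ 1 * 2 ^ 1 * 2 ^ 15 * 2 ^ 14 * 2 ^ (S.d + 1) * (2 ^ 12 * 2 ^ (S.d + 2) * 2 ^ 1 * 2 ^ 15) ^ (S.d + 1)) * M := by
      rw [hM]
      have e1 : mRp S.d ^ (2 * S.d + 3) = mRp S.d * (mRp S.d * mRp S.d) ^ (S.d + 1) := by ring
      rw [e1]; ring
    rw [key]
    have key2 : PadicW80Par.Ap ^ (S.d + 1) * mRp S.d ^ (2 * S.d + 3) * ((∏ j, P.Vs j) * P.Vel) * P.Wstarp * P.Gp *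
        (2 ^ (S.d + 1)) ^ S.d * P.𝔘p ^ (S.d + 1) * (2 ^ 14) ^ (S.d + 1) * P.Wstarp ^ (S.d + 1)
        = (PadicW80Par.Ap ^ (S.d + 1) * ((2 : ℝ) ^ (S.d + 1)) ^ S.d * (2 ^ 14) ^ (S.d + 1)) * M := by
      rw [hM]; ring
    rw [key2]
    have hVV : 0 ≤ (∏ j, P.Vs j) * P.Vel := by rw [← hprodV]; exact hVall.le
    have hM0 : 0 ≤ M := by rw [hM]; positivity
    refine mul_le_mul_of_nonneg_right ?_ hM0
    -- constants: `2^{30+d} · 2^{(28+d)(d+1)} ≤ 2^{50(d+1)} · 2^{(d+1)d} · 2^{14(d+1)}`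
    rw [show PadicW80Par.Ap = (2 : ℝ) ^ 50 from rfl]
    have hexp : 1 + 1 + 15 + 14 + (S.d + 1) + (12 + (S.d + 2) + 1 + 15) * (S.d + 1) ≤
        50 * (S.d + 1) + (S.d + 1) * S.d + 14 * (S.d + 1) := by
      have e : (12 + (S.d + 2) + 1 + 15) * (S.d + 1) = 30 * (S.d + 1) + (S.d + 1) * S.d := by ring
      rw [e]
      generalize (S.d + 1) * S.d = q
      omega
    calc (2 : ℝ) ^ 1 * 2 ^ 1 * 2 ^ 15 * 2 ^ 14 * 2 ^ (S.d + 1) * (2 ^ 12 * 2 ^ (S.d + 2) * 2 ^ 1 * 2 ^ 15) ^ (S.d + 1)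
        = 2 ^ (1 + 1 + 15 + 14 + (S.d + 1) + (12 + (S.d + 2) + 1 + 15) * (S.d + 1)) := by
          simp only [← pow_mul, ← pow_add]
      _ ≤ 2 ^ (50 * (S.d + 1) + (S.d + 1) * S.d + 14 * (S.d + 1)) := pow_le_pow_right₀ (by norm_num) hexp
      _ = (2 ^ 50) ^ (S.d + 1) * (2 ^ (S.d + 1)) ^ S.d * (2 ^ 14) ^ (S.d + 1) := by
          simp only [← pow_mul, ← pow_add]
  -- (5) combine
  calc (2 : ℝ) * (P.S₀p * ((tauSet S.d P.Tp).card : ℝ))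
      ≤ 2 * (P.S₀p * ((2 * (P.Tp : ℝ)) ^ (S.d + 1) / (S.d + 1).factorial)) := by gcongr
    _ ≤ 2 * (P.S₀p * ((2 * (P.𝔘p / (cTp * P.Wstarp))) ^ (S.d + 1) / (S.d + 1).factorial)) := by
        gcongr
    _ = A₁ / B₁ := eL
    _ ≤ A₂ / B₂ := heart
    _ = (P.𝔘p / (cLp * P.Gp)) * (P.Up ^ (S.d + 1) / (D ^ (S.d + 1) * ∏ i, P.Vallp i)) := eR.symm
    _ ≤ (P.hparp * P.Lbp) * ∏ i, ((P.Lallp i : ℝ) + 1) := by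
        refine mul_le_mul h3 h5 (by positivity) (by positivity)
    _ = P.hparp * P.Lbp * ∏ i, ((P.Lallp i : ℝ) + 1) := by ring


variable {d : ℕ} (P : PadicW80Par d)

/-! ### Two small inputs of the parameter pack: `log p ≤ U` and the rooms -/

/-- `log p ≤ U` from the height floor `log p ≤ V_θ` (`U ≥ V_θ`, all other factors `≥ 1`).
[cite: Waldschmidt1980, §3.2 (p. 264)] -/
theorem log_p_le_U {p : ℕ} (hpV : Real.log p ≤ P.Vel) : Real.log p ≤ P.Up := by
  have h := P.U_div_ge
  have hG := P.one_le_G; have hW := P.one_le_Wstar; have hV := P.one_le_prodV; have hVθ := P.one_le_Vθ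
  have hU := P.U_pos
  have h2 : (1 : ℝ) ≤ 2 ^ (49 * (d + 1)) := one_le_pow₀ (by norm_num)
  have h3 : P.Vel ≤ 2 ^ (49 * (d + 1)) * P.Gp * ((∏ j, P.Vs j) * P.Vel) * P.Wstarp := by
    calc P.Vel = 1 * 1 * (1 * P.Vel) * 1 := by ring
      _ ≤ 2 ^ (49 * (d + 1)) * P.Gp * ((∏ j, P.Vs j) * P.Vel) * P.Wstarp := by
          gcongr
  have h4 : P.Up / 2 ^ (d + 1) ≤ P.Up := div_le_self hU.le (one_le_pow₀ (by norm_num))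
  linarith

/-- Room for the inner chain AND the half step: `2(d+1)·t_J ≤ T/2^J` (`t_J = ⌊(T/2^J)/(2m)⌋`),
hence `(d+1)·t_J ≤ T/2^J` and `T/2^{J+1} + t_J ≤ T/2^J − d·t_J`… in the form p3's J3 uses:
`T/2^(J+1) + (d+1)·t_J ≤ T/2^J`. [cite: Waldschmidt1980, Lemma 3.6 (p. 272)] -/
theorem room_half (J : ℕ) : P.Tp / 2 ^ (J + 1) + (d + 1) * P.tJp J ≤ P.Tp / 2 ^ J := by
  have h : 2 * ((d + 1) * P.tJp J) ≤ P.Tp / 2 ^ J := by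
    have := P.tJ_mul_le J; rwa [mul_assoc] at this
  have h2 : P.Tp / 2 ^ (J + 1) = P.Tp / 2 ^ J / 2 := by
    rw [pow_succ, Nat.div_div_eq_div_mul]
  rw [h2]
  omega

end PadicW80Par

end Summit.ABC.StewartYu

end
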